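import Summits.KontsevichZagierPeriods.KontsevichZagierPeriods.Theorems.PentagonInKZ.Negative.EvalInstance
import Literature.NumberTheory.Transcendental.AssociatorsPentagonWeightTwo

/-!
# `PentagonInKZ` (stmt-KontsevichZagierPeriods-11348) — negative knowledge, part 7: the regularisation is load-bearing

Companion of part 2 (`LoadBearing.lean`).  The crux series `Φ_χ` assigns to a DIVERGENT binary
word the shuffle-regularised combination `reg_ш` of convergent classes (IKZ); replacing it by `0`
(`cruxSeriesNoReg`: raw signed class on convergent words, `0` elsewhere) breaks Drinfeld's pentagon
at `χ = eval` already in weight 2 (`not_pentagonInKZNoReg`): the pentagon forces `c_{yx} = -c_{xy}`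
(`NCSeries.DrinfeldPentagon.apply_weight_two`, `AssociatorsPentagonWeightTwo.lean`) while
`c_{xy} = -ζ(2) ≠ 0`.  So the regularised coefficients (the route's "corner constant terms") carry
content from weight 2 on: `c_{yx}(Φ) = +χ⟦ζ(2)⟧`. [cite: Furusho2003, Prop. 3.2.3; IharaKanekoZagier2006, §3]
-/

noncomputable section

open Literature.NumberTheory.Transcendental

namespace Summit.KontsevichZagierPeriods.FurushoPentagon.PentagonInKZNegative

open Summit.KontsevichZagierPeriods.KontsevichZagierPeriods.Theses.FurushoPentagon (PentagonInKZ)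

/-! ## §14 The shuffle REGULARISATION is load-bearing already in weight 2 -/

/-- The crux series WITHOUT regularisation: the raw signed class on a convergent word, `0` on every
non-convergent word (instead of `reg_ш`). [folklore] -/
def cruxSeriesNoReg (R : Type) [CommRing R] [Algebra ℚ R] (χ : KZ.FormalRep →+ R)
    (Z : List ℕ → KZ.FormalRep) : NCSeries Bool R :=
  fun W : List Bool => (-1 : R) ^ (W.count true) *
    (if MZV.IsConvergentWord W then χ (Z (MZV.ofBinaryWord W)) else (0 : R))

/-- **Dropping the regularisation breaks the pentagon at `χ = eval` in weight 2**: the pentagon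
forces `c_{yx} = -c_{xy}` (`NCSeries.DrinfeldPentagon.apply_weight_two`, landed
`AssociatorsPentagonWeightTwo.lean`), but without regularisation `c_{yx} = 0` while
`c_{xy} = -ζ(2) ≠ 0`.  So the regularised (divergent-word) coefficients — the corner constant
terms the route worries about — are load-bearing from weight 2 on (`c_{yx}(Φ_KZ) = +ζ(2)`).
[cite: Furusho2003, Prop. 3.2.3; IharaKanekoZagier2006, §3] -/
theorem not_pentagonInKZNoReg :
    ¬ (∀ (R : Type) [CommRing R] [Algebra ℚ R] (χ : KZ.FormalRep →+ R),
        (∀ c ∈ KZ.relations, χ c = 0) → (∀ a b, χ (a * b) = χ a * χ b) → (∃ u, χ u = 1) →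
        ∀ Z : List ℕ → KZ.FormalRep, AgreesWithSimplex Z →
          NCSeries.DrinfeldPentagon (cruxSeriesNoReg R χ Z)) := by
  intro h
  have hp := h ℝ KZ.eval eval_rel KZ.eval_mul' ⟨_, eval_of_unit⟩ simplexZ simplexZ_agrees
  have h0 : cruxSeriesNoReg ℝ KZ.eval simplexZ [] = 1 := by
    have : MZV.ofBinaryWord [] = [] := by decide
    simp [cruxSeriesNoReg, MZV.IsConvergentWord, this, agrees_nil simplexZ_agrees]
  have hx : cruxSeriesNoReg ℝ KZ.eval simplexZ [false] = 0 := by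
    simp [cruxSeriesNoReg, MZV.IsConvergentWord]
  have hy : cruxSeriesNoReg ℝ KZ.eval simplexZ [true] = 0 := by
    simp [cruxSeriesNoReg, MZV.IsConvergentWord]
  obtain ⟨-, -, hyx⟩ := NCSeries.DrinfeldPentagon.apply_weight_two hp h0 hx hy
  have htf : cruxSeriesNoReg ℝ KZ.eval simplexZ [true, false] = 0 := by
    simp [cruxSeriesNoReg, MZV.IsConvergentWord]
  have hft : cruxSeriesNoReg ℝ KZ.eval simplexZ [false, true] = -multipleZeta [2] := by
    have : MZV.ofBinaryWord [false, true] = [2] := by decide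
    simp [cruxSeriesNoReg, MZV.IsConvergentWord, this, simplexZ_agrees [2] (by decide)]
    exact KZ.mzvRep_value_holds _ _ _ _
  rw [htf, hft, neg_neg] at hyx
  have p2 := multipleZeta_pos_of_isAdmissible_holds (s := [2]) (by decide)
  linarith


end Summit.KontsevichZagierPeriods.FurushoPentagon.PentagonInKZNegative
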